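import Literature.MathematicalPhysics.QuantumFieldTheory.BalabanImbrieJaffe1984to88.BIJ88Eq5613Kinetic
import Literature.MathematicalPhysics.QuantumFieldTheory.BalabanImbrieJaffe1984to88.BIJ88Vj5610Operator

/-!
# `BalabanImbrieJaffe1984to88.BIJ88Eq5613DeltaLoc` — T. Bałaban, J. Imbrie, A. Jaffe, *Effective action and cluster properties of
the abelian Higgs model*, Commun. Math. Phys. **114** (1988) 257–315 [BalabanImbrieJaffe1988], §5.6 p. 288 [PDF 32]: **(5.6.13) for
the localized quadratic form `½⟨Λ₈^{(k−1)′}φ, Δ_{k,loc}(u)Λ₈^{(k−1)′}φ⟩`** ((2.34): `Δ_{k,loc}(u) = a_kI − a_k²Q_k(u)G_{k,loc}(u)Q_k^*(u)`)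
at KERNEL level — second MODEL INSTANCE of the bookkeeping file `BIJ88Eq5613Summary`: along the interpolation
`e′ ↦ ũ_{k+1}e^{ie′e_kηθ_kH_{k,loc}A^{(k)}}` of (5.6.14) the block averages `Q_k`, `Q_k^*` carry the phases `e^{±ie′A}` of
`BIJ88Eq5613Kinetic` and the propagator `G_{k,loc}(ũ_{k+1}e^{ie′…})` enters as a smooth kernel family with DISPLAYED row-sum bounds on
its `e′`-derivatives (*"the regularity properties of G_j(ũ_{k+1}), D_{ũ_{k+1}}G_j(ũ_{k+1}) imply that we can develop this expansion
to any order"*, p. 287); the site densities are smooth, their `n`-th derivatives obey `|dⁿ/de′ⁿ| ≤ ½a²‖v(x)‖V_cΓ_n`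
(`Γ_n = Σ_i C(n,i)(2A₀)^iγ_{n−i}`, `≤ g·n!·(2A₀ + C_G)ⁿ` for `γ_m ≤ g·m!·C_Gᵐ`), the order-`> n̄` remainders `W₁,Δ(x)` and cube terms
`W₁,Δ(□)` are explicit and obey *"|W₁^{(k)}(□)| ≦ e_k^{n̄−1−α}"* for small `e_k` under displayed small-field hypotheses

statement-level skeleton of published theorems with citation tags; proofs where landed; nothing here is a claim about the Yang–Mills mass gap

PDF held: `paper:balaban1988-cmp114-bij-abelian-higgs-effective-action` (journal page = PDF page + 256); p. 288 [PDF 32], p. 287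
[PDF 31] and p. 263 [PDF 7] ((2.34)–(2.37)) read as images this session (renders in the seat folder and in
`HOME/lit-balaban-r16/renders/cmp114/`).

CITATION HEADER (lean-in-tree rule).  Part of the lit-balaban TYPED SKELETON (HOME `run/shared/lean/pub/lit-balaban/`), PHASE-2 proof
seat p31 gen 11 (unit `lit-balaban-p31-g11`; TAKING line HOME/STATUS.md 2026-08-22T02:59Z).  WHAT IS REPRODUCED: row `C2.Eq5.6.13` of
`HOME/lit-balaban-r16/ROWS-C2-part2.md` (owner r16), kind «model-instance» for the SECOND of the three action terms of (5.6.13),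
p. 288 [PDF 32], verbatim: *"… + ½⟨Λ₈^{(k−1)′}φ̃, Δ_{k,loc}(u′_k)Λ₈^{(k−1)′}φ̃⟩ + … = … + ½⟨Λ₈^{(k−1)′}φ, Δ_{k,loc}(ũ_{k+1})Λ₈^{(k−1)′}φ⟩ + …
+ R^{(k)}(u_{k+1}, θ_kH_{k,loc}A^{(k)}) + Σ_□ W₁^{(k)}(□). (5.6.13) … Here W₁^{(k)}(□) is localized near □, an r(e_k)-cube in Λ₂^{(k)}, and
|W₁^{(k)}(□)| ≦ e_k^{n̄−1−α}. (Two powers of e_k may be needed to beat the bounds on φ.) If we define R̃^{(k)}(…) = Σ_{n=1}^{n̄}[dⁿ/de′ⁿ(… +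
½⟨Λ₈^{(k−1)′}φ, Δ_{k,loc}(…)Λ₈^{(k−1)′}φ⟩ + …)]_{e′=0}, (5.6.14) then R^{(k)} can be obtained by replacing propagators G_k(□, ũ_{k+1}) with
G_{k,loc}(ũ_{k+1}) and eliminating extra kernels ζ″_k explicitly"*; with (2.34) p. 263 *"Δ_{k,loc}(u) = a_kI − a_k²Q_k(u)G_{k,loc}(u)Q_k^*(u)"*
and the reading of the form of record (r16's `BIJ88InductiveForm41.scalarForm`: `⟨Λ₈′φ, ΔΛ₈′φ⟩ = Re Σ_{x,y} \overline{φ(x)}Δ(x,y)φ(y)`).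

THE MECHANISM.  With `v = Λ₈^{(k−1)′}φ` on the coarse sites and the interpolated block-average kernel `Q(e′)(x,z) = wU(x,z)e^{ie′A(x,z)}`
(`z ∈ B(x)`; `BIJ88Eq5613Kinetic.ephase`), `(Q(e′)G(e′)Q(e′)ᴴv)(x) = Σ_{z∈B(x)} Σ_{z′} Σ_{y: z′∈B(y)} c·e^{ie′(A(x,z)−A(y,z′))}·G(e′)(z,z′)`
with `c = wU(x,z)·\overline{wU(y,z′)}·v(y)` (`sand`, `sand_eq_sum₃`): every summand is ONE phase times ONE propagator entry, so by
Leibniz `dⁿ/de′ⁿ = c·Σ_i C(n,i)(i(A(x,z)−A(y,z′)))^i e^{ie′(…)}·dⁿ⁻ⁱG(z,z′)/de′ⁿ⁻ⁱ` (`iteratedDeriv_sand`) and, with `|U| ≤ 1`,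
`|A| ≤ A₀`, the row normalisation `|w||B(x)| ≤ 1`, the column weight `Σ_{y: z′∈B(y)}|w|‖v(y)‖ ≤ V_c` and the DISPLAYED propagator
bounds `Σ_{z′}|dᵐG(e′)(z,z′)/de′ᵐ| ≤ γ_m` on `[0,1]`: `‖dⁿ(QGQᴴv)(x)/de′ⁿ‖ ≤ V_c·Γ_n`, `Γ_n = Σ_iC(n,i)(2A₀)^iγ_{n−i}`
(`norm_iteratedDeriv_sand_le`), `Γ_n ≤ g·n!·(2A₀ + C_G)ⁿ` if `γ_m ≤ g·m!·C_Gᵐ` (`Gamma_le_of_factorial`; `Gamma_le_of_geometric` for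
the factorial-free case).  The site density
`d_x(e′) = ½[a‖v(x)‖² − a²Re(\overline{v(x)}(QGQᴴv)(x))]` (`dlt`) then has `|dⁿd_x/de′ⁿ| ≤ ½a²‖v(x)‖V_cΓ_n` (`n ≥ 1`,
`abs_iteratedDeriv_dlt_le`), its order-`> n̄` Taylor remainder `W₁,Δ(x)` obeys `|W₁,Δ(x)| ≤ ½a²‖v(x)‖V_cΓ_{n̄+1}/n̄!` and in print's
currency (`γ_m ≤ g·m!·C_Gᵐ`, `A₀, C_G ≤ c·e_kp(e_k)`, `e_kΦ ≤ c_Φp(e_k)`, `|□| ≤ r(e_k)^d`) `|W₁,Δ(□)| ≤ K·e_k^{n̄−1}(log e_k⁻¹)^{p(n̄+3)+rd} ≤ e_k^{n̄−1−α}`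
below the explicit threshold (`ineq5613_delta`).

WHAT IS PROVED (0 `sorry`, standard axioms; definitions with bodies + theorems, no `Prop` facts).
* §1 `qKer`/`sand`/`dlt` and the dictionary: `qKer_eq_qMat` (the kernel IS p31 g10's `BIJ88Vj5610Operator.qMat` of the interpolated
  transporters), **`sand_eq_mulVec`** (`sand = (Q(e′)·G(e′)·Q(e′)ᴴ)v` as matrices), `dlt_zero` (`e′ = 0`: the form of `Δ_{k,loc}(ũ_{k+1})`).
* §2 `ephase_mul_conj`, `sand_eq_sum₃`, `contDiff_sand`, **`iteratedDeriv_sand`**, `contDiff_dlt`, `iteratedDeriv_re_comp`,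
  **`iteratedDeriv_dlt_succ`**.
* §3 `Gamma`, **`norm_iteratedDeriv_sand_le`** (`V_cΓ_n`), `Gamma_le_of_geometric` (`g(2A₀+C_G)ⁿ`), `Gamma_le_of_factorial`
  (`g·n!·(2A₀+C_G)ⁿ`), **`abs_iteratedDeriv_dlt_le`**.
* §4 `W1dlt` (p02's `Ftilde`), **`eq5613_dlt_site`**, **`abs_W1dlt_le`**; §5 `W1dltCube`, **`eq5613_delta`** (the Δ-line of (5.6.13)
  with `Σ_□`), `abs_W1dltCube_le`; §6 locality `sand_congr`/`W1dltCube_congr`; §7 `dltConst`, `abs_W1dlt_le_scale`,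
  `abs_W1dltCube_le_scale`, **`ineq5613_delta`** (r16's leaf `BIJ88Sect5StatementsPart2.Ineq5613` for `W₁ = W1dltCube …`).
HONEST SCOPE.  The propagator family `G(e′) = G_{k,loc}(ũ_{k+1}e^{ie′…})` is DATA with displayed smoothness and derivative row-sum
bounds `γ_m` (print derives them from (5.6.11)–(5.6.12) and the regularity of `G_j`, `D_{ũ}G_j` — p31 g10 `BIJ88ExpansionAnyOrder287`
is the resolvent version; the `e′`-derivative version is not re-derived here); `Q_k^*` is read as the conjugate-transpose kernel
(lattice weights absorbed into `w`, `a`); the `R̃^{(k)} → R^{(k)}` localization (`G_k(□) → G_{k,loc}`, `ζ″_k`) is the datum `δR` of the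
companion file and is not touched; the third action term `𝒫_{k,loc}` is deferred by the paper (p. 275).  Imports the companion
`BIJ88Eq5613Kinetic` (phases) and p31 g10's `BIJ88Vj5610Operator` (dictionary only); no Summits import; modifies nothing.  Unit
`lit-balaban-p31` (literature-prover-lit-balaban-p31-g11-0), 2026-08-22.  NOT summit progress; NOT continuum; NOT Clay.
-/

noncomputable section

open Complex
open scoped BigOperators ComplexConjugate Matrix
open Set

namespace Literature.MathematicalPhysics.QuantumFieldTheory.BalabanImbrieJaffe1984to88.BIJ88Eq5613DeltaLoc

open BIJ88Eq5613Kinetic (ephase twist ephase_eq norm_ephase ephase_zero iteratedDeriv_ephase contDiff_ephase)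
open BIJ88TaylorSplit5614 (Rtilde Ftilde)
open BIJ88Eq5613Summary (split norm_Ftilde_le_of_contDiff Rtilde_sum cubeSum cubeSum_congr norm_cubeSum_le sum_eq_sum_cubeSum
  ineq5613_of_cube_bounds threshold pLog_eq_rpow rLen_eq_rpow log_rpow_mul_log_rpow log_rpow_pow le_one_of_le_exp_neg_one)
open BIJ88Eq5613Kinetic (kinLogPower)
open BIJ88Sect5StatementsPart2 (Ineq5613)
open BIJ88Sect2Statements (pLog rLen)

variable {α β : Type*} [Fintype α] [DecidableEq α]

/-! ## §1 The kernels: `Q_k(u(e′))`, the sandwich `Q G Q^*` and the site density of `½⟨v, Δ_{k,loc}v⟩` -/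

/-- The kernel of the interpolated block average `Q_k(ũ_{k+1}e^{ie′…})`: `Q(e′)(x,z) = wU(x,z)e^{ie′A(x,z)}` for `z ∈ B(x)`, `0` otherwise
(`w = η^d`, `U(x,z) = ũ_{k+1}(Γ^{(k)}_{x,z})`, `A(x,z) = e_kη(θ_kH_{k,loc}A^{(k)})(Γ^{(k)}_{x,z})`). [cite: BalabanImbrieJaffe1988, (5.6.14) p.288] -/
def qKer (B : β → Finset α) (w : ℝ) (U : β → α → ℂ) (A : β → α → ℝ) (t : ℝ) (x : β) (z : α) : ℂ :=
  if z ∈ B x then (w : ℂ) * U x z * ephase (A x z) t else 0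

omit [Fintype α] in
/-- kernel (dictionary): `Q(e′)` IS p31 g10's matrix `qMat` of the interpolated transporters `twist U A e′`.
[cite: BalabanImbrieJaffe1988, (5.6.8) p.287] -/
theorem qKer_eq_qMat [Fintype α] (B : β → Finset α) (w : ℝ) (U : β → α → ℂ) (A : β → α → ℝ) (t : ℝ) (x : β) (z : α) :
    qKer B w U A t x z = BIJ88Vj5610Operator.qMat B w (twist U A t) x z := by
  simp only [qKer, BIJ88Vj5610Operator.qMat, Matrix.of_apply, twist, mul_assoc]

/-- **`(Q(e′)G(e′)Q(e′)^*v)(x)`** — the sandwich of (2.34) applied to `v = Λ₈^{(k−1)′}φ` at the coarse site `x`, along the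
interpolation: `Σ_{z∈B(x)} Q(e′)(x,z) Σ_{z′} G(e′)(z,z′) Σ_{y∈Y: z′∈B(y)} \overline{Q(e′)(y,z′)} v(y)` (`Q^*` read as the
conjugate-transpose kernel; `Y` = the coarse sites carrying `v`). [cite: BalabanImbrieJaffe1988, (2.34) p.263] -/
def sand (B : β → Finset α) (w : ℝ) (U : β → α → ℂ) (A : β → α → ℝ) (G : ℝ → α → α → ℂ) (v : β → ℂ) (Y : Finset β)
    (t : ℝ) (x : β) : ℂ :=
  ∑ z ∈ B x, ((w : ℂ) * U x z * ephase (A x z) t) *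
    ∑ z', G t z z' * ∑ y ∈ Y.filter (fun y => z' ∈ B y), conj ((w : ℂ) * U y z' * ephase (A y z') t) * v y

/-- **The site density of `½⟨v, Δ_{k,loc}(u(e′))v⟩`** (form of record: `Re Σ_{x,y}\overline{v(x)}Δ(x,y)v(y)`, r16's `scalarForm`):
`d_x(e′) = ½[a‖v(x)‖² − a²·Re(\overline{v(x)}·(Q(e′)G(e′)Q(e′)^*v)(x))]`, `Δ_{k,loc} = aI − a²QGQ^*` (2.34).
[cite: BalabanImbrieJaffe1988, (5.6.14) p.288] -/
def dlt (a : ℝ) (B : β → Finset α) (w : ℝ) (U : β → α → ℂ) (A : β → α → ℝ) (G : ℝ → α → α → ℂ) (v : β → ℂ) (Y : Finset β)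
    (t : ℝ) (x : β) : ℝ :=
  (1 / 2) * (a * ‖v x‖ ^ 2 - a ^ 2 * (conj (v x) * sand B w U A G v Y t x).re)

omit [Fintype α] [DecidableEq α] in
/-- kernel: reordering a triple finite sum. [cite: BalabanImbrieJaffe1988, (2.34) p.263] -/
private theorem sum_comm₃ {ι₁ ι₂ ι₃ : Type*} (s₁ : Finset ι₁) (s₂ : Finset ι₂) (s₃ : Finset ι₃) (f : ι₁ → ι₂ → ι₃ → ℂ) :
    ∑ a ∈ s₁, ∑ b ∈ s₂, ∑ c ∈ s₃, f a b c = ∑ c ∈ s₃, ∑ b ∈ s₂, ∑ a ∈ s₁, f a b c := by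
  have h1 : ∑ a ∈ s₁, ∑ b ∈ s₂, ∑ c ∈ s₃, f a b c = ∑ a ∈ s₁, ∑ c ∈ s₃, ∑ b ∈ s₂, f a b c :=
    Finset.sum_congr rfl fun a _ => Finset.sum_comm
  have h2 : ∑ a ∈ s₁, ∑ c ∈ s₃, ∑ b ∈ s₂, f a b c = ∑ c ∈ s₃, ∑ a ∈ s₁, ∑ b ∈ s₂, f a b c := Finset.sum_comm
  have h3 : ∑ c ∈ s₃, ∑ a ∈ s₁, ∑ b ∈ s₂, f a b c = ∑ c ∈ s₃, ∑ b ∈ s₂, ∑ a ∈ s₁, f a b c :=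
    Finset.sum_congr rfl fun c _ => Finset.sum_comm
  rw [h1, h2, h3]

/-- kernel (dictionary, operator level): for `Y` = all coarse sites, `sand … e′ x = ((Q(e′)·G(e′)·Q(e′)ᴴ)v)(x)` with `Q(e′) = qMat B w
(twist U A e′)` (p31 g10) and `G(e′)` the propagator matrix. [cite: BalabanImbrieJaffe1988, (2.34) p.263] -/
theorem sand_eq_mulVec [Fintype β] [DecidableEq β] (B : β → Finset α) (w : ℝ) (U : β → α → ℂ) (A : β → α → ℝ)
    (G : ℝ → α → α → ℂ) (v : β → ℂ) (t : ℝ) (x : β) :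
    sand B w U A G v Finset.univ t x
      = ((BIJ88Vj5610Operator.qMat B w (twist U A t) * Matrix.of (G t) * (BIJ88Vj5610Operator.qMat B w (twist U A t))ᴴ)
          *ᵥ v) x := by
  classical
  have hQ : ∀ y z, BIJ88Vj5610Operator.qMat B w (twist U A t) y z = qKer B w U A t y z :=
    fun y z => (qKer_eq_qMat B w U A t y z).symm
  -- the left side as the triple sum `Σ_z Σ_{z′} Σ_y Q(x,z)G(z,z′)conj(Q(y,z′))v(y)` over all indices
  have hL : sand B w U A G v Finset.univ t x
      = ∑ z, ∑ z', ∑ y, qKer B w U A t x z * G t z z' * conj (qKer B w U A t y z') * v y := by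
    unfold sand
    rw [← Finset.sum_subset (Finset.subset_univ (B x))
      (f := fun z => ∑ z', ∑ y, qKer B w U A t x z * G t z z' * conj (qKer B w U A t y z') * v y)
      (fun z _ hz => by simp [qKer, hz])]
    refine Finset.sum_congr rfl fun z hz => ?_
    rw [Finset.mul_sum]
    refine Finset.sum_congr rfl fun z' _ => ?_
    rw [Finset.sum_filter, Finset.mul_sum, Finset.mul_sum]
    refine Finset.sum_congr rfl fun y _ => ?_
    by_cases hy : z' ∈ B y
    · rw [if_pos hy, qKer, if_pos hz, qKer, if_pos hy]; ring
    · rw [if_neg hy, qKer, qKer, if_neg hy]; simp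
  have hR : ((BIJ88Vj5610Operator.qMat B w (twist U A t) * Matrix.of (G t) * (BIJ88Vj5610Operator.qMat B w (twist U A t))ᴴ)
          *ᵥ v) x = ∑ y, ∑ z', ∑ z, qKer B w U A t x z * G t z z' * conj (qKer B w U A t y z') * v y := by
    simp only [Matrix.mulVec, dotProduct, Matrix.mul_apply, Matrix.conjTranspose_apply, Matrix.of_apply, hQ,
      Complex.star_def]
    refine Finset.sum_congr rfl fun y _ => ?_
    rw [Finset.sum_mul]
    refine Finset.sum_congr rfl fun z' _ => ?_
    rw [Finset.sum_mul, Finset.sum_mul]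
  rw [hL, hR, sum_comm₃]

omit [DecidableEq α] in
/-- kernel: combined phases — `e^{ie′a}·\overline{e^{ie′b}} = e^{ie′(a−b)}`. [cite: BalabanImbrieJaffe1988, (5.6.14) p.288] -/
theorem ephase_mul_conj (a b t : ℝ) : ephase a t * conj (ephase b t) = ephase (a - b) t := by
  rw [ephase, ephase, ephase, ← Complex.exp_conj, ← Complex.exp_add]
  congr 1
  simp only [map_mul, Complex.conj_ofReal, Complex.conj_I]
  push_cast
  ring

/-- kernel: the sandwich as ONE triple sum of `coefficient × one phase × one propagator entry`:
`Σ_{z∈B(x)}Σ_{z′}Σ_{y: z′∈B(y)} [wU(x,z)\overline{wU(y,z′)}v(y)]·e^{ie′(A(x,z)−A(y,z′))}·G(e′)(z,z′)`.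
[cite: BalabanImbrieJaffe1988, (5.6.14) p.288] -/
theorem sand_eq_sum₃ (B : β → Finset α) (w : ℝ) (U : β → α → ℂ) (A : β → α → ℝ) (G : ℝ → α → α → ℂ) (v : β → ℂ)
    (Y : Finset β) (t : ℝ) (x : β) :
    sand B w U A G v Y t x = ∑ z ∈ B x, ∑ z', ∑ y ∈ Y.filter (fun y => z' ∈ B y),
      (((w : ℂ) * U x z) * conj ((w : ℂ) * U y z') * v y) * (ephase (A x z - A y z') t * G t z z') := by
  unfold sand
  refine Finset.sum_congr rfl fun z _ => ?_
  rw [Finset.mul_sum]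
  refine Finset.sum_congr rfl fun z' _ => ?_
  rw [Finset.mul_sum, Finset.mul_sum]
  refine Finset.sum_congr rfl fun y _ => ?_
  rw [← ephase_mul_conj, map_mul]
  ring

/-- kernel: at `e′ = 0` the density is that of `Δ_{k,loc}(ũ_{k+1})` (no phases) — the right side's term of (5.6.13).
[cite: BalabanImbrieJaffe1988, (5.6.13) p.288] -/
theorem dlt_zero (a : ℝ) (B : β → Finset α) (w : ℝ) (U : β → α → ℂ) (A : β → α → ℝ) (G : ℝ → α → α → ℂ) (v : β → ℂ)
    (Y : Finset β) (x : β) :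
    dlt a B w U A G v Y 0 x = (1 / 2) * (a * ‖v x‖ ^ 2 - a ^ 2 *
      (conj (v x) * ∑ z ∈ B x, ((w : ℂ) * U x z) * ∑ z', G 0 z z' *
        ∑ y ∈ Y.filter (fun y => z' ∈ B y), conj ((w : ℂ) * U y z') * v y).re) := by
  simp [dlt, sand, ephase_zero]

/-! ## §2 Smoothness and the derivative formulas -/

section Smooth

variable (B : β → Finset α) (w : ℝ) (U : β → α → ℂ) (A : β → α → ℝ) {G : ℝ → α → α → ℂ} (v : β → ℂ) (Y : Finset β)

/-- kernel: one summand `c·e^{ie′δ}·G(e′)(z,z′)` is smooth when the propagator entry is. [cite: BalabanImbrieJaffe1988, (5.6.14) p.288] -/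
theorem contDiff_term (c : ℂ) (δ : ℝ) {g : ℝ → ℂ} {n : WithTop ℕ∞} (hg : ContDiff ℝ n g) :
    ContDiff ℝ n (fun t => c * (ephase δ t * g t)) :=
  contDiff_const.mul ((contDiff_ephase δ).mul hg)

/-- kernel: Leibniz for one summand — `dⁿ/de′ⁿ[c·e^{ie′δ}g] = c·Σ_i C(n,i)(iδ)^i e^{ie′δ}·g^{(n−i)}`.
[cite: BalabanImbrieJaffe1988, (5.6.14) p.288] -/
theorem iteratedDeriv_term (c : ℂ) (δ : ℝ) {g : ℝ → ℂ} (hg : ∀ n : ℕ, ContDiff ℝ n g) (n : ℕ) (t : ℝ) :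
    iteratedDeriv n (fun t => c * (ephase δ t * g t)) t
      = c * ∑ i ∈ Finset.range (n + 1), (n.choose i : ℂ) * ((δ * I) ^ i * ephase δ t) * iteratedDeriv (n - i) g t := by
  rw [iteratedDeriv_const_mul _ (((contDiff_ephase δ).mul (hg n)).contDiffAt)]
  congr 1
  have h := iteratedDeriv_mul (n := n) (x := t) (f := ephase δ) (g := g) (contDiff_ephase δ).contDiffAt (hg n).contDiffAt
  have hfg : (ephase δ * g) = fun t => ephase δ t * g t := rfl
  rw [hfg] at h
  rw [h]
  refine Finset.sum_congr rfl fun i _ => ?_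
  rw [iteratedDeriv_ephase]

/-- kernel: the sandwich is smooth in `e′` (propagator entries smooth). [cite: BalabanImbrieJaffe1988, (5.6.14) p.288] -/
theorem contDiff_sand (hG : ∀ z z', ∀ n : ℕ, ContDiff ℝ n (fun t => G t z z')) (x : β) {n : ℕ} :
    ContDiff ℝ n (fun t => sand B w U A G v Y t x) := by
  have hf : (fun t => sand B w U A G v Y t x) = fun t => ∑ z ∈ B x, ∑ z', ∑ y ∈ Y.filter (fun y => z' ∈ B y),
      (((w : ℂ) * U x z) * conj ((w : ℂ) * U y z') * v y) * (ephase (A x z - A y z') t * G t z z') := by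
    funext t; exact sand_eq_sum₃ B w U A G v Y t x
  rw [hf]
  exact ContDiff.sum fun z _ => ContDiff.sum fun z' _ => ContDiff.sum fun y _ => contDiff_term _ _ (hG z z' n)

/-- **The derivatives of the sandwich**: `dⁿ(QGQ^*v)(x)/de′ⁿ = Σ_{z,z′,y} c·Σ_i C(n,i)(i(A(x,z)−A(y,z′)))^i e^{ie′(…)}·dⁿ⁻ⁱG(z,z′)/de′ⁿ⁻ⁱ`
— every `e′`-derivative falls either on a phase (one power of the contour sums, i.e. of `e_k`) or on the propagator.
[cite: BalabanImbrieJaffe1988, (5.6.14) p.288] -/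
theorem iteratedDeriv_sand (hG : ∀ z z', ∀ n : ℕ, ContDiff ℝ n (fun t => G t z z')) (x : β) (n : ℕ) (t : ℝ) :
    iteratedDeriv n (fun t => sand B w U A G v Y t x) t = ∑ z ∈ B x, ∑ z', ∑ y ∈ Y.filter (fun y => z' ∈ B y),
      (((w : ℂ) * U x z) * conj ((w : ℂ) * U y z') * v y) *
        ∑ i ∈ Finset.range (n + 1), (n.choose i : ℂ) * (((A x z - A y z' : ℝ) * I) ^ i * ephase (A x z - A y z') t) *
          iteratedDeriv (n - i) (fun t => G t z z') t := by
  have hf : (fun t => sand B w U A G v Y t x) = fun t => ∑ z ∈ B x, ∑ z', ∑ y ∈ Y.filter (fun y => z' ∈ B y),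
      (((w : ℂ) * U x z) * conj ((w : ℂ) * U y z') * v y) * (ephase (A x z - A y z') t * G t z z') := by
    funext t; exact sand_eq_sum₃ B w U A G v Y t x
  rw [hf]
  rw [iteratedDeriv_fun_sum fun z _ => (ContDiff.sum fun z' _ => ContDiff.sum fun y _ => contDiff_term _ _ (hG z z' n)).contDiffAt]
  refine Finset.sum_congr rfl fun z _ => ?_
  rw [iteratedDeriv_fun_sum fun z' _ => (ContDiff.sum fun y _ => contDiff_term _ _ (hG z z' n)).contDiffAt]
  refine Finset.sum_congr rfl fun z' _ => ?_
  rw [iteratedDeriv_fun_sum fun y _ => (contDiff_term (n := n) _ _ (hG z z' n)).contDiffAt]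
  refine Finset.sum_congr rfl fun y _ => ?_
  rw [iteratedDeriv_term _ _ (hG z z')]

/-- kernel: `Re` commutes with `e′`-derivatives of smooth complex families. [cite: BalabanImbrieJaffe1988, (5.6.14) p.288] -/
theorem iteratedDeriv_re_comp {g : ℝ → ℂ} (hg : ∀ n : ℕ, ContDiff ℝ n g) :
    ∀ n : ℕ, iteratedDeriv n (fun t => (g t).re) = fun t => (iteratedDeriv n g t).re
  | 0 => by funext t; simp
  | n + 1 => by
    funext t
    rw [iteratedDeriv_succ, iteratedDeriv_re_comp hg n, iteratedDeriv_succ]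
    have hd : DifferentiableAt ℝ (iteratedDeriv n g) t :=
      ((hg (n + 1)).differentiable_iteratedDeriv n (by exact_mod_cast Nat.lt_succ_self n)).differentiableAt
    have h2 := Complex.reCLM.hasFDerivAt.comp_hasDerivAt t hd.hasDerivAt
    exact h2.deriv

/-- kernel: the site density is smooth in `e′`. [cite: BalabanImbrieJaffe1988, (5.6.14) p.288] -/
theorem contDiff_dlt (a : ℝ) (hG : ∀ z z', ∀ n : ℕ, ContDiff ℝ n (fun t => G t z z')) (x : β) {n : ℕ} :
    ContDiff ℝ n (fun t => dlt a B w U A G v Y t x) := by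
  unfold dlt
  have h1 : ContDiff ℝ n (fun t => conj (v x) * sand B w U A G v Y t x) := contDiff_const.mul (contDiff_sand B w U A v Y hG x)
  have h2 : ContDiff ℝ n (fun t => (conj (v x) * sand B w U A G v Y t x).re) := Complex.reCLM.contDiff.comp h1
  exact contDiff_const.mul (contDiff_const.sub (contDiff_const.mul h2))

/-- **The derivatives of the site density**: for `n ≥ 1`, `dⁿd_x/de′ⁿ = −½a²·Re(\overline{v(x)}·dⁿ(QGQ^*v)(x)/de′ⁿ)` (the `a‖v‖²`
part is constant). [cite: BalabanImbrieJaffe1988, (5.6.14) p.288] -/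
theorem iteratedDeriv_dlt_succ (a : ℝ) (hG : ∀ z z', ∀ n : ℕ, ContDiff ℝ n (fun t => G t z z')) (x : β) (n : ℕ) (t : ℝ) :
    iteratedDeriv (n + 1) (fun t => dlt a B w U A G v Y t x) t
      = -(1 / 2) * a ^ 2 * (conj (v x) * iteratedDeriv (n + 1) (fun t => sand B w U A G v Y t x) t).re := by
  have hs : ∀ m : ℕ, ContDiff ℝ m (fun t => conj (v x) * sand B w U A G v Y t x) :=
    fun m => contDiff_const.mul (contDiff_sand B w U A v Y hG x)
  have hre : ∀ m : ℕ, ContDiff ℝ m (fun t => (conj (v x) * sand B w U A G v Y t x).re) :=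
    fun m => Complex.reCLM.contDiff.comp (hs m)
  unfold dlt
  rw [iteratedDeriv_const_mul _ ((contDiff_const.sub (contDiff_const.mul (hre _))).contDiffAt),
    iteratedDeriv_const_sub (Nat.succ_pos n), iteratedDeriv_neg,
    iteratedDeriv_const_mul _ ((hre _).contDiffAt)]
  rw [iteratedDeriv_re_comp hs (n + 1)]
  simp only
  rw [iteratedDeriv_const_mul _ ((contDiff_sand B w U A v Y hG x).contDiffAt)]
  ring

end Smooth

/-! ## §3 The derivative bounds -/

section Bounds

/-- `Γ_n = Σ_{i=0}^{n} C(n,i)(2A₀)^iγ_{n−i}` — the combinatorial bound for the `n`-th derivative of the sandwich (`i` derivatives on the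
phases, `n − i` on the propagator). [cite: BalabanImbrieJaffe1988, (5.6.14) p.288] -/
def Gamma (A₀ : ℝ) (γ : ℕ → ℝ) (n : ℕ) : ℝ := ∑ i ∈ Finset.range (n + 1), (n.choose i : ℝ) * (2 * A₀) ^ i * γ (n - i)

/-- kernel: `Γ_n ≥ 0`. [cite: BalabanImbrieJaffe1988, (5.6.14) p.288] -/
theorem Gamma_nonneg {A₀ : ℝ} (hA₀ : 0 ≤ A₀) {γ : ℕ → ℝ} (hγ : ∀ m, 0 ≤ γ m) (n : ℕ) : 0 ≤ Gamma A₀ γ n :=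
  Finset.sum_nonneg fun i _ => mul_nonneg (mul_nonneg (Nat.cast_nonneg _) (pow_nonneg (by linarith) _)) (hγ _)

/-- **Geometric propagator bounds give a geometric `Γ`**: `γ_m ≤ gC_Gᵐ` (each `e′`-derivative of `G(ũ_{k+1}e^{ie′…})` costs one power
of the `V_j`-scale `C_G = O(e_kp(e_k))`, (5.6.10)–(5.6.12)) ⟹ `Γ_n ≤ g(2A₀ + C_G)ⁿ` (binomial theorem).
[cite: BalabanImbrieJaffe1988, (5.6.14) p.288] -/
theorem Gamma_le_of_geometric {A₀ g CG : ℝ} (hA₀ : 0 ≤ A₀) {γ : ℕ → ℝ}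
    (hγ : ∀ m, γ m ≤ g * CG ^ m) (n : ℕ) : Gamma A₀ γ n ≤ g * (2 * A₀ + CG) ^ n := by
  unfold Gamma
  calc ∑ i ∈ Finset.range (n + 1), (n.choose i : ℝ) * (2 * A₀) ^ i * γ (n - i)
      ≤ ∑ i ∈ Finset.range (n + 1), (n.choose i : ℝ) * (2 * A₀) ^ i * (g * CG ^ (n - i)) :=
        Finset.sum_le_sum fun i _ => mul_le_mul_of_nonneg_left (hγ _) (by positivity)
    _ = g * ∑ i ∈ Finset.range (n + 1), (2 * A₀) ^ i * CG ^ (n - i) * (n.choose i : ℝ) := by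
        rw [Finset.mul_sum]; exact Finset.sum_congr rfl fun i _ => by ring
    _ = g * (2 * A₀ + CG) ^ n := by rw [← add_pow]

/-- **Propagator bounds with factorials give `Γ_n ≤ g·n!·(2A₀ + C_G)ⁿ`**: `γ_m ≤ g·m!·C_Gᵐ` (the generic growth of the
`e′`-derivatives of an analytic inverse family) ⟹ `Γ_n ≤ g·n!·(2A₀ + C_G)ⁿ` (since `C(n,i)(n−i)! = n!/i! ≤ n!·C(n,i)`).
[cite: BalabanImbrieJaffe1988, (5.6.14) p.288] -/
theorem Gamma_le_of_factorial {A₀ g CG : ℝ} (hA₀ : 0 ≤ A₀) (hg : 0 ≤ g) (hCG : 0 ≤ CG) {γ : ℕ → ℝ}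
    (hγ : ∀ m, γ m ≤ g * m.factorial * CG ^ m) (n : ℕ) : Gamma A₀ γ n ≤ g * n.factorial * (2 * A₀ + CG) ^ n := by
  unfold Gamma
  have key : ∀ i ∈ Finset.range (n + 1), (n.choose i : ℝ) * (2 * A₀) ^ i * γ (n - i)
      ≤ g * n.factorial * ((2 * A₀) ^ i * CG ^ (n - i) * (n.choose i : ℝ)) := by
    intro i hi
    rw [Finset.mem_range] at hi
    have hfac : ((n - i).factorial : ℝ) ≤ n.factorial := by exact_mod_cast Nat.factorial_le (Nat.sub_le n i)
    calc (n.choose i : ℝ) * (2 * A₀) ^ i * γ (n - i)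
        ≤ (n.choose i : ℝ) * (2 * A₀) ^ i * (g * (n - i).factorial * CG ^ (n - i)) :=
          mul_le_mul_of_nonneg_left (hγ _) (by positivity)
      _ ≤ (n.choose i : ℝ) * (2 * A₀) ^ i * (g * n.factorial * CG ^ (n - i)) := by gcongr
      _ = g * n.factorial * ((2 * A₀) ^ i * CG ^ (n - i) * (n.choose i : ℝ)) := by ring
  refine (Finset.sum_le_sum key).trans ?_
  rw [← Finset.mul_sum, ← add_pow]

variable {B : β → Finset α} {w : ℝ} {U : β → α → ℂ} {A : β → α → ℝ} {G : ℝ → α → α → ℂ} {v : β → ℂ} {Y : Finset β}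

/-- kernel: one Leibniz sum — `‖Σ_i C(n,i)(iδ)^i e^{ie′δ} g^{(n−i)}‖ ≤ Σ_i C(n,i)(2A₀)^i‖g^{(n−i)}‖` for `|δ| ≤ 2A₀`.
[cite: BalabanImbrieJaffe1988, (5.6.14) p.288] -/
theorem norm_leibniz_sum_le {δ A₀ : ℝ} (hδ : |δ| ≤ 2 * A₀) (g : ℝ → ℂ) (n : ℕ) (t : ℝ) :
    ‖∑ i ∈ Finset.range (n + 1), (n.choose i : ℂ) * (((δ : ℝ) * I) ^ i * ephase δ t) * iteratedDeriv (n - i) g t‖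
      ≤ ∑ i ∈ Finset.range (n + 1), (n.choose i : ℝ) * (2 * A₀) ^ i * ‖iteratedDeriv (n - i) g t‖ := by
  refine (norm_sum_le _ _).trans (Finset.sum_le_sum fun i _ => ?_)
  rw [norm_mul, norm_mul, norm_mul, norm_pow, norm_mul, Complex.norm_I, mul_one, Complex.norm_real, Real.norm_eq_abs,
    norm_ephase, mul_one, Complex.norm_natCast]
  gcongr

/-- **`‖dⁿ(Q G Q^* v)(x)/de′ⁿ‖ ≤ V_c·Γ_n`** on `[0,1]`, from: unit transporters `|U| ≤ 1`, contour sums `|A| ≤ A₀`, the row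
normalisation `|w|·|B(x)| ≤ 1`, the column weight `Σ_{y∈Y: z′∈B(y)}|w|‖v(y)‖ ≤ V_c`, and the DISPLAYED propagator regularity
`Σ_{z′}‖dᵐG(e′)(z,z′)/de′ᵐ‖ ≤ γ_m` (`m ≤ n`, `e′ ∈ [0,1]`). [cite: BalabanImbrieJaffe1988, (5.6.13) p.288] -/
theorem norm_iteratedDeriv_sand_le {A₀ Vc : ℝ} {γ : ℕ → ℝ} (hA₀ : 0 ≤ A₀) (hVc : 0 ≤ Vc) (hγ : ∀ m, 0 ≤ γ m)
    (hG : ∀ z z', ∀ n : ℕ, ContDiff ℝ n (fun t => G t z z'))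
    (hU : ∀ y z, z ∈ B y → ‖U y z‖ ≤ 1) (hA : ∀ y z, z ∈ B y → |A y z| ≤ A₀) (hw : ∀ x, |w| * (B x).card ≤ 1)
    (hcol : ∀ z', ∑ y ∈ Y.filter (fun y => z' ∈ B y), |w| * ‖v y‖ ≤ Vc) {n : ℕ} {t : ℝ} (ht : t ∈ Set.Icc (0 : ℝ) 1)
    (hγG : ∀ m ≤ n, ∀ z, ∑ z', ‖iteratedDeriv m (fun s => G s z z') t‖ ≤ γ m) (x : β) :
    ‖iteratedDeriv n (fun t => sand B w U A G v Y t x) t‖ ≤ Vc * Gamma A₀ γ n := by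
  have _ := ht
  rw [iteratedDeriv_sand B w U A v Y hG x n t]
  -- innermost bound, for fixed z, z′
  have hin : ∀ z ∈ B x, ∀ z', ‖∑ y ∈ Y.filter (fun y => z' ∈ B y),
      (((w : ℂ) * U x z) * conj ((w : ℂ) * U y z') * v y) *
        ∑ i ∈ Finset.range (n + 1), (n.choose i : ℂ) * (((A x z - A y z' : ℝ) * I) ^ i * ephase (A x z - A y z') t) *
          iteratedDeriv (n - i) (fun t => G t z z') t‖
      ≤ (|w| * ‖U x z‖) * Vc *
          ∑ i ∈ Finset.range (n + 1), (n.choose i : ℝ) * (2 * A₀) ^ i * ‖iteratedDeriv (n - i) (fun t => G t z z') t‖ := by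
    intro z hz z'
    refine (norm_sum_le _ _).trans ?_
    have hterm : ∀ y ∈ Y.filter (fun y => z' ∈ B y),
        ‖(((w : ℂ) * U x z) * conj ((w : ℂ) * U y z') * v y) *
          ∑ i ∈ Finset.range (n + 1), (n.choose i : ℂ) * (((A x z - A y z' : ℝ) * I) ^ i * ephase (A x z - A y z') t) *
            iteratedDeriv (n - i) (fun t => G t z z') t‖
        ≤ (|w| * ‖U x z‖) * (|w| * ‖v y‖) *
          ∑ i ∈ Finset.range (n + 1), (n.choose i : ℝ) * (2 * A₀) ^ i * ‖iteratedDeriv (n - i) (fun t => G t z z') t‖ := by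
      intro y hy
      rw [Finset.mem_filter] at hy
      have hδ : |A x z - A y z'| ≤ 2 * A₀ := by
        have h1 := hA x z hz; have h2 := hA y z' hy.2
        calc |A x z - A y z'| ≤ |A x z| + |A y z'| := abs_sub _ _
          _ ≤ A₀ + A₀ := add_le_add h1 h2
          _ = 2 * A₀ := by ring
      rw [norm_mul]
      refine mul_le_mul ?_ (norm_leibniz_sum_le hδ _ n t) (norm_nonneg _) (by positivity)
      rw [norm_mul, norm_mul, norm_mul, Complex.norm_real, Real.norm_eq_abs, Complex.norm_conj, norm_mul, Complex.norm_real,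
        Real.norm_eq_abs]
      have hU' : ‖U y z'‖ ≤ 1 := hU y z' hy.2
      calc |w| * ‖U x z‖ * (|w| * ‖U y z'‖) * ‖v y‖ ≤ |w| * ‖U x z‖ * (|w| * 1) * ‖v y‖ := by gcongr
        _ = |w| * ‖U x z‖ * (|w| * ‖v y‖) := by ring
    refine (Finset.sum_le_sum hterm).trans ?_
    rw [← Finset.sum_mul, ← Finset.mul_sum]
    refine mul_le_mul_of_nonneg_right (mul_le_mul_of_nonneg_left (hcol z') (by positivity)) ?_
    exact Finset.sum_nonneg fun i _ => by positivity
  -- sum over z′ using the propagator row sums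
  have hmid : ∀ z ∈ B x, ‖∑ z', ∑ y ∈ Y.filter (fun y => z' ∈ B y),
      (((w : ℂ) * U x z) * conj ((w : ℂ) * U y z') * v y) *
        ∑ i ∈ Finset.range (n + 1), (n.choose i : ℂ) * (((A x z - A y z' : ℝ) * I) ^ i * ephase (A x z - A y z') t) *
          iteratedDeriv (n - i) (fun t => G t z z') t‖
      ≤ (|w| * ‖U x z‖) * Vc * Gamma A₀ γ n := by
    intro z hz
    refine (norm_sum_le _ _).trans ((Finset.sum_le_sum fun z' _ => hin z hz z').trans ?_)
    rw [← Finset.mul_sum]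
    refine mul_le_mul_of_nonneg_left ?_ (by positivity)
    -- `Σ_{z′} Σ_i C(n,i)(2A₀)^i ‖G^{(n−i)}(z,z′)‖ = Σ_i C(n,i)(2A₀)^i Σ_{z′} ‖…‖ ≤ Γ_n`
    rw [Finset.sum_comm]
    unfold Gamma
    refine Finset.sum_le_sum fun i hi => ?_
    rw [← Finset.mul_sum]
    refine mul_le_mul_of_nonneg_left (hγG (n - i) (Nat.sub_le n i) z) (by positivity)
  -- sum over z ∈ B(x) using the row normalisation
  refine (norm_sum_le _ _).trans ((Finset.sum_le_sum fun z hz => hmid z hz).trans ?_)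
  rw [← Finset.sum_mul, ← Finset.sum_mul]
  have hrow : ∑ z ∈ B x, |w| * ‖U x z‖ ≤ 1 := by
    calc ∑ z ∈ B x, |w| * ‖U x z‖ ≤ ∑ z ∈ B x, |w| * 1 :=
          Finset.sum_le_sum fun z hz => mul_le_mul_of_nonneg_left (hU x z hz) (abs_nonneg _)
      _ = |w| * (B x).card := by rw [Finset.sum_const, nsmul_eq_mul]; ring
      _ ≤ 1 := hw x
  calc (∑ z ∈ B x, |w| * ‖U x z‖) * Vc * Gamma A₀ γ n ≤ 1 * Vc * Gamma A₀ γ n := by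
        gcongr
        exact Gamma_nonneg hA₀ hγ n
    _ = Vc * Gamma A₀ γ n := by ring

/-- **The derivative bound of the `Δ_{k,loc}` site density**: for `n ≥ 1` and `e′ ∈ [0,1]`,
`|dⁿd_x/de′ⁿ| ≤ ½a²‖v(x)‖V_cΓ_n` (hypotheses of `norm_iteratedDeriv_sand_le`). [cite: BalabanImbrieJaffe1988, (5.6.13) p.288] -/
theorem abs_iteratedDeriv_dlt_le (a : ℝ) {A₀ Vc : ℝ} {γ : ℕ → ℝ} (hA₀ : 0 ≤ A₀) (hVc : 0 ≤ Vc) (hγ : ∀ m, 0 ≤ γ m)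
    (hG : ∀ z z', ∀ n : ℕ, ContDiff ℝ n (fun t => G t z z'))
    (hU : ∀ y z, z ∈ B y → ‖U y z‖ ≤ 1) (hA : ∀ y z, z ∈ B y → |A y z| ≤ A₀) (hw : ∀ x, |w| * (B x).card ≤ 1)
    (hcol : ∀ z', ∑ y ∈ Y.filter (fun y => z' ∈ B y), |w| * ‖v y‖ ≤ Vc) {n : ℕ} {t : ℝ} (ht : t ∈ Set.Icc (0 : ℝ) 1)
    (hγG : ∀ m ≤ n + 1, ∀ z, ∑ z', ‖iteratedDeriv m (fun s => G s z z') t‖ ≤ γ m) (x : β) :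
    |iteratedDeriv (n + 1) (fun t => dlt a B w U A G v Y t x) t| ≤ (1 / 2) * a ^ 2 * ‖v x‖ * (Vc * Gamma A₀ γ (n + 1)) := by
  rw [iteratedDeriv_dlt_succ B w U A v Y a hG x n t]
  have h1 := norm_iteratedDeriv_sand_le hA₀ hVc hγ hG hU hA hw hcol ht hγG x
  have h2 : |(conj (v x) * iteratedDeriv (n + 1) (fun t => sand B w U A G v Y t x) t).re|
      ≤ ‖v x‖ * (Vc * Gamma A₀ γ (n + 1)) := by
    refine (Complex.abs_re_le_norm _).trans ?_
    rw [norm_mul, Complex.norm_conj]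
    exact mul_le_mul_of_nonneg_left h1 (norm_nonneg _)
  rw [abs_mul, show |(-(1 / 2) * a ^ 2 : ℝ)| = (1 / 2) * a ^ 2 by
    rw [abs_of_nonpos (by nlinarith [sq_nonneg a])]; ring]
  calc (1 / 2) * a ^ 2 * |(conj (v x) * iteratedDeriv (n + 1) (fun t => sand B w U A G v Y t x) t).re|
      ≤ (1 / 2) * a ^ 2 * (‖v x‖ * (Vc * Gamma A₀ γ (n + 1))) := mul_le_mul_of_nonneg_left h2 (by positivity)
    _ = (1 / 2) * a ^ 2 * ‖v x‖ * (Vc * Gamma A₀ γ (n + 1)) := by ring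

end Bounds

/-! ## §4 The order-`> n̄` Taylor remainder `W₁,Δ(x)` -/

section Taylor

variable (a : ℝ) (B : β → Finset α) (w : ℝ) (U : β → α → ℂ) (A : β → α → ℝ) (G : ℝ → α → α → ℂ) (v : β → ℂ) (Y : Finset β)

/-- **`W₁,Δ(x)`**: the `Δ_{k,loc}`-term site contribution to `Σ_□W₁^{(k)}(□)` of (5.6.13) from the *"terms of higher than n̄-th order in
e_k"* — the Taylor remainder of order `> n̄` at `e′ = 1` of the site density (p02's `Ftilde`). [cite: BalabanImbrieJaffe1988, (5.6.13) p.288] -/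
def W1dlt (nbar : ℕ) (x : β) : ℝ := Ftilde (fun t => dlt a B w U A G v Y t x) nbar

/-- **(5.6.13) for the `Δ_{k,loc}` site density**: `d_x(1) = d_x(0) + R̃_x + W₁,Δ(x)` — the form at `ũ_{k+1}e^{iA}` = the form at
`ũ_{k+1}` + its part of `R̃^{(k)}` + the remainder. [cite: BalabanImbrieJaffe1988, (5.6.13) p.288] -/
theorem eq5613_dlt_site (nbar : ℕ) (x : β) :
    dlt a B w U A G v Y 1 x = dlt a B w U A G v Y 0 x + Rtilde (fun t => dlt a B w U A G v Y t x) nbar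
      + W1dlt a B w U A G v Y nbar x := by
  unfold W1dlt
  exact split (fun t => dlt a B w U A G v Y t x) nbar

variable {B w U A G v Y}

/-- **`|W₁,Δ(x)| ≤ ½a²‖v(x)‖V_cΓ_{n̄+1}/n̄!`** under the hypotheses of `norm_iteratedDeriv_sand_le` (propagator regularity up to order
`n̄ + 1` on `[0,1]`). [cite: BalabanImbrieJaffe1988, (5.6.13) p.288] -/
theorem abs_W1dlt_le {A₀ Vc : ℝ} {γ : ℕ → ℝ} (hA₀ : 0 ≤ A₀) (hVc : 0 ≤ Vc) (hγ : ∀ m, 0 ≤ γ m)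
    (hG : ∀ z z', ∀ n : ℕ, ContDiff ℝ n (fun t => G t z z'))
    (hU : ∀ y z, z ∈ B y → ‖U y z‖ ≤ 1) (hA : ∀ y z, z ∈ B y → |A y z| ≤ A₀) (hw : ∀ x, |w| * (B x).card ≤ 1)
    (hcol : ∀ z', ∑ y ∈ Y.filter (fun y => z' ∈ B y), |w| * ‖v y‖ ≤ Vc) (nbar : ℕ)
    (hγG : ∀ t ∈ Set.Icc (0 : ℝ) 1, ∀ m ≤ nbar + 1, ∀ z, ∑ z', ‖iteratedDeriv m (fun s => G s z z') t‖ ≤ γ m) (x : β) :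
    |W1dlt a B w U A G v Y nbar x| ≤ (1 / 2) * a ^ 2 * ‖v x‖ * (Vc * Gamma A₀ γ (nbar + 1)) / nbar.factorial := by
  rw [W1dlt, ← Real.norm_eq_abs]
  exact norm_Ftilde_le_of_contDiff (fun _ => contDiff_dlt B w U A v Y a hG x) fun t ht => by
    rw [Real.norm_eq_abs]
    exact abs_iteratedDeriv_dlt_le a hA₀ hVc hγ hG hU hA hw hcol ht (hγG t ht) x

end Taylor

/-! ## §5 Sites and cubes: the `Δ_{k,loc}` line of (5.6.13) -/

section Cubes

variable {γι : Type*} [DecidableEq γι]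
variable (a : ℝ) (B : β → Finset α) (w : ℝ) (U : β → α → ℂ) (A : β → α → ℝ) (G : ℝ → α → α → ℂ) (v : β → ℂ) (Y : Finset β)

/-- **`W₁,Δ(□) = Σ_{x∈□}W₁,Δ(x)`** — the cube term (companion `cubeSum` over a cube assignment of the coarse sites `X`).
[cite: BalabanImbrieJaffe1988, (5.6.13) p.288] -/
def W1dltCube (nbar : ℕ) (X : Finset β) (cube : β → γι) (c : γι) : ℝ :=
  cubeSum X cube (W1dlt a B w U A G v Y nbar) c

/-- **The `Δ_{k,loc}` line of (5.6.13)**: `Σ_x d_x(1) = Σ_x d_x(0) + R̃_Δ + Σ_□ W₁,Δ(□)` with `R̃_Δ = R̃` of the total family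
(= `Σ_xR̃_x` for smooth propagator entries) and the last sum over the cubes met by the sites `X`.
[cite: BalabanImbrieJaffe1988, (5.6.13) p.288] -/
theorem eq5613_delta (hG : ∀ z z', ∀ n : ℕ, ContDiff ℝ n (fun t => G t z z')) (nbar : ℕ) (X : Finset β) (cube : β → γι) :
    ∑ x ∈ X, dlt a B w U A G v Y 1 x
      = ∑ x ∈ X, dlt a B w U A G v Y 0 x + Rtilde (fun t => ∑ x ∈ X, dlt a B w U A G v Y t x) nbar
        + ∑ c ∈ X.image cube, W1dltCube a B w U A G v Y nbar X cube c := by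
  unfold W1dltCube
  rw [Rtilde_sum X (fun x _ _ => contDiff_dlt B w U A v Y a hG x) nbar, ← sum_eq_sum_cubeSum, ← Finset.sum_add_distrib,
    ← Finset.sum_add_distrib]
  exact Finset.sum_congr rfl fun x _ => eq5613_dlt_site a B w U A G v Y nbar x

variable {B w U A G v Y}

/-- kernel: `|W₁,Δ(□)| ≤ |□|·b` from a uniform site bound on `□`. [cite: BalabanImbrieJaffe1988, (5.6.13) p.288] -/
theorem abs_W1dltCube_le (nbar : ℕ) (X : Finset β) (cube : β → γι) (c : γι) {b : ℝ}
    (hb : ∀ x ∈ X, cube x = c → |W1dlt a B w U A G v Y nbar x| ≤ b) :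
    |W1dltCube a B w U A G v Y nbar X cube c| ≤ (X.filter (fun x => cube x = c)).card * b := by
  have h := norm_cubeSum_le X cube (W1dlt a B w U A G v Y nbar) c (b := b) (fun x hx hc => by
    rw [Real.norm_eq_abs]; exact hb x hx hc)
  rwa [Real.norm_eq_abs] at h

end Cubes

/-! ## §6 Locality -/

section Locality

variable {γι : Type*} [DecidableEq γι]

/-- kernel: the sandwich at `x` depends only on `U(x,·)`, `A(x,·)` on `B(x)`, on the propagator rows `G(z,·)`, `z ∈ B(x)`, and on
`v`, `U`, `A` at the sites `y` coupled to those rows (*"All terms are local"*: with the range (2.37) of `G_{k,loc}` this is a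
neighbourhood of `x`). [cite: BalabanImbrieJaffe1988, (5.6.13) p.288] -/
theorem sand_congr {B : β → Finset α} {w : ℝ} {U U' : β → α → ℂ} {A A' : β → α → ℝ} {G G' : ℝ → α → α → ℂ} {v v' : β → ℂ}
    {Y : Finset β} {x : β} (hUx : ∀ z ∈ B x, U x z = U' x z) (hAx : ∀ z ∈ B x, A x z = A' x z)
    (hG : ∀ z ∈ B x, ∀ z' t, G t z z' = G' t z z')
    (hy : ∀ z ∈ B x, ∀ z', ∀ y ∈ Y, z' ∈ B y → (∀ t, G t z z' = 0) ∨ (U y z' = U' y z' ∧ A y z' = A' y z' ∧ v y = v' y)) (t : ℝ) :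
    sand B w U A G v Y t x = sand B w U' A' G' v' Y t x := by
  unfold sand
  refine Finset.sum_congr rfl fun z hz => ?_
  rw [hUx z hz, hAx z hz]
  congr 1
  refine Finset.sum_congr rfl fun z' _ => ?_
  rw [hG z hz z' t]
  rcases eq_or_ne (G' t z z') 0 with h0 | hne
  · rw [h0, zero_mul, zero_mul]
  · congr 1
    refine Finset.sum_congr rfl fun y hy' => ?_
    rw [Finset.mem_filter] at hy'
    rcases hy z hz z' y hy'.1 hy'.2 with hzero | ⟨h1, h2, h3⟩
    · exact absurd (by rw [← hG z hz z' t]; exact hzero t) hne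
    · rw [h1, h2, h3]

/-- **"W₁^{(k)}(□) is localized near □"** for the `Δ_{k,loc}` term: `W₁,Δ(□)` is unchanged under changes of the data away from the
sites of `□`, their blocks, the propagator rows issued from those blocks and the sites coupled to them (hypotheses of `sand_congr`
at every `x ∈ □`, plus `v(x)`). [cite: BalabanImbrieJaffe1988, (5.6.13) p.288] -/
theorem W1dltCube_congr (a : ℝ) {B : β → Finset α} {w : ℝ} {U U' : β → α → ℂ} {A A' : β → α → ℝ} {G G' : ℝ → α → α → ℂ}
    {v v' : β → ℂ} {Y : Finset β} (nbar : ℕ) (X : Finset β) (cube : β → γι) (c : γι)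
    (hv : ∀ x ∈ X, cube x = c → v x = v' x)
    (hUx : ∀ x ∈ X, cube x = c → ∀ z ∈ B x, U x z = U' x z) (hAx : ∀ x ∈ X, cube x = c → ∀ z ∈ B x, A x z = A' x z)
    (hG : ∀ x ∈ X, cube x = c → ∀ z ∈ B x, ∀ z' t, G t z z' = G' t z z')
    (hy : ∀ x ∈ X, cube x = c → ∀ z ∈ B x, ∀ z', ∀ y ∈ Y, z' ∈ B y →
      (∀ t, G t z z' = 0) ∨ (U y z' = U' y z' ∧ A y z' = A' y z' ∧ v y = v' y)) :
    W1dltCube a B w U A G v Y nbar X cube c = W1dltCube a B w U' A' G' v' Y nbar X cube c := by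
  unfold W1dltCube
  refine cubeSum_congr X cube fun x hx hc => ?_
  unfold W1dlt
  have hfun : (fun t => dlt a B w U A G v Y t x) = fun t => dlt a B w U' A' G' v' Y t x := by
    funext t
    rw [dlt, dlt, hv x hx hc, sand_congr (hUx x hx hc) (hAx x hx hc) (hG x hx hc) (hy x hx hc) t]
  rw [hfun]

end Locality

/-! ## §7 The printed bound `|W₁^{(k)}(□)| ≦ e_k^{n̄−1−α}` for the `Δ_{k,loc}` term -/

section Scale

variable {γι : Type*} [DecidableEq γι]
variable {a : ℝ} {B : β → Finset α} {w : ℝ} {U : β → α → ℂ} {A : β → α → ℝ} {G : ℝ → α → α → ℂ} {v : β → ℂ} {Y : Finset β}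

/-- The constant of the `Δ_{k,loc}` bound: `K = ½a²g(n̄+1)(2c_A + c_G)^{n̄+1}c_Φ²` (the `(n̄+1)!` of the propagator derivatives
against the `1/n̄!` of the Taylor remainder). [cite: BalabanImbrieJaffe1988, (5.6.13) p.288] -/
def dltConst (a g cA cG cΦ : ℝ) (nbar : ℕ) : ℝ := (1 / 2) * a ^ 2 * g * (nbar + 1) * (2 * cA + cG) ^ (nbar + 1) * cΦ ^ 2

/-- kernel: `K ≥ 0`. [cite: BalabanImbrieJaffe1988, (5.6.13) p.288] -/
theorem dltConst_nonneg {a g cA cG cΦ : ℝ} (hg : 0 ≤ g) (hcA : 0 ≤ cA) (hcG : 0 ≤ cG) (nbar : ℕ) :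
    0 ≤ dltConst a g cA cG cΦ nbar := by
  unfold dltConst; positivity

/-- **The `Δ_{k,loc}` site bound in print's currency**: propagator regularity `γ_m ≤ g·m!·C_Gᵐ` with `C_G ≤ c_Ge·p(e)`, contour
sums `A₀ ≤ c_Ae·p(e)`, field bounds `‖v(x)‖ ≤ Φ`, `V_c ≤ Φ` with `eΦ ≤ c_Φp(e)` (`e = e_k`, `p(e)` of (2.33)) give
`|W₁,Δ(x)| ≤ K·e^{n̄−1}·p(e)^{n̄+3}` — `n̄ + 1` powers of `e_k`, two spent on the field bounds.
[cite: BalabanImbrieJaffe1988, (5.6.13) p.288] -/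
theorem abs_W1dlt_le_scale {e p g cA cG cΦ A₀ CG Vc Φ : ℝ} {γ : ℕ → ℝ} (he : 0 < e) (hg : 0 ≤ g)
    (hcΦ : 0 ≤ cΦ) (hA₀ : 0 ≤ A₀) (hCG0 : 0 ≤ CG) (hVc : 0 ≤ Vc) (hγ0 : ∀ m, 0 ≤ γ m)
    (hγ : ∀ m, γ m ≤ g * m.factorial * CG ^ m) (hA₀e : A₀ ≤ cA * e * pLog p e) (hCGe : CG ≤ cG * e * pLog p e)
    (hVcΦ : Vc ≤ Φ)
    (hΦ : e * Φ ≤ cΦ * pLog p e) (hG : ∀ z z', ∀ n : ℕ, ContDiff ℝ n (fun t => G t z z'))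
    (hU : ∀ y z, z ∈ B y → ‖U y z‖ ≤ 1) (hA : ∀ y z, z ∈ B y → |A y z| ≤ A₀) (hw : ∀ x, |w| * (B x).card ≤ 1)
    (hcol : ∀ z', ∑ y ∈ Y.filter (fun y => z' ∈ B y), |w| * ‖v y‖ ≤ Vc) (nbar : ℕ)
    (hγG : ∀ t ∈ Set.Icc (0 : ℝ) 1, ∀ m ≤ nbar + 1, ∀ z, ∑ z', ‖iteratedDeriv m (fun s => G s z z') t‖ ≤ γ m)
    {x : β} (hvx : ‖v x‖ ≤ Φ) :
    |W1dlt a B w U A G v Y nbar x| ≤ dltConst a g cA cG cΦ nbar * e ^ ((nbar : ℝ) - 1) * pLog p e ^ (nbar + 3) := by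
  have hP : 0 ≤ pLog p e := Real.rpow_nonneg (abs_nonneg _) _
  refine (abs_W1dlt_le a hA₀ hVc hγ0 hG hU hA hw hcol nbar hγG x).trans ?_
  have hΓ : Gamma A₀ γ (nbar + 1) ≤ g * (nbar + 1).factorial * (2 * A₀ + CG) ^ (nbar + 1) :=
    Gamma_le_of_factorial hA₀ hg hCG0 hγ (nbar + 1)
  have hAC : 2 * A₀ + CG ≤ (2 * cA + cG) * e * pLog p e := by nlinarith
  have hpow : (2 * A₀ + CG) ^ (nbar + 1) ≤ ((2 * cA + cG) * e * pLog p e) ^ (nbar + 1) :=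
    pow_le_pow_left₀ (by positivity) hAC _
  have hΦ' : Φ ≤ cΦ * pLog p e / e := by rw [le_div_iff₀ he]; linarith
  have hv' : ‖v x‖ ≤ cΦ * pLog p e / e := hvx.trans hΦ'
  have hVc' : Vc ≤ cΦ * pLog p e / e := hVcΦ.trans hΦ'
  have hΓ' : Vc * Gamma A₀ γ (nbar + 1) ≤ (cΦ * pLog p e / e) * (g * (nbar + 1).factorial *
      ((2 * cA + cG) ^ (nbar + 1) * e ^ (nbar + 1) * pLog p e ^ (nbar + 1))) := by
    have h2 : Gamma A₀ γ (nbar + 1)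
        ≤ g * (nbar + 1).factorial * ((2 * cA + cG) ^ (nbar + 1) * e ^ (nbar + 1) * pLog p e ^ (nbar + 1)) := by
      rw [← mul_pow, ← mul_pow]; exact hΓ.trans (mul_le_mul_of_nonneg_left hpow (by positivity))
    exact mul_le_mul hVc' h2 (Gamma_nonneg hA₀ hγ0 _) (div_nonneg (mul_nonneg hcΦ hP) he.le)
  have hK0 : 0 ≤ (1 / 2) * a ^ 2 := by positivity
  have hfac : ((nbar + 1).factorial : ℝ) = (nbar + 1) * nbar.factorial := by
    rw [Nat.factorial_succ]; push_cast; ring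
  have hnf : (nbar.factorial : ℝ) ≠ 0 := by exact_mod_cast (Nat.factorial_pos nbar).ne'
  calc (1 / 2) * a ^ 2 * ‖v x‖ * (Vc * Gamma A₀ γ (nbar + 1)) / nbar.factorial
      ≤ (1 / 2) * a ^ 2 * (cΦ * pLog p e / e) * ((cΦ * pLog p e / e) * (g * (nbar + 1).factorial *
          ((2 * cA + cG) ^ (nbar + 1) * e ^ (nbar + 1) * pLog p e ^ (nbar + 1)))) / nbar.factorial := by
        refine div_le_div_of_nonneg_right ?_ (Nat.cast_nonneg _)
        exact mul_le_mul (mul_le_mul_of_nonneg_left hv' hK0) hΓ'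
          (mul_nonneg hVc (Gamma_nonneg hA₀ hγ0 _)) (mul_nonneg hK0 (div_nonneg (mul_nonneg hcΦ hP) he.le))
    _ = dltConst a g cA cG cΦ nbar * (e ^ (nbar + 1) / e / e) * pLog p e ^ (nbar + 3) := by
        unfold dltConst; rw [hfac]; field_simp; ring
    _ = dltConst a g cA cG cΦ nbar * e ^ ((nbar : ℝ) - 1) * pLog p e ^ (nbar + 3) := by
        congr 2
        rw [div_div, ← pow_two, ← Real.rpow_natCast, ← Real.rpow_natCast, ← Real.rpow_sub he]
        push_cast; ring_nf

/-- **The `Δ_{k,loc}` cube bound in print's currency**: with moreover `|□| ≤ r(e)^d` coarse sites per cube and `e ≤ e⁻¹`,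
`|W₁,Δ(□)| ≤ K·e^{n̄−1}·(log e⁻¹)^{p(n̄+3)+rd}` (the log power is the companion's `kinLogPower`).
[cite: BalabanImbrieJaffe1988, (5.6.13) p.288] -/
theorem abs_W1dltCube_le_scale {e p r g cA cG cΦ A₀ CG Vc Φ : ℝ} {γ : ℕ → ℝ} {d : ℕ} (he : 0 < e) (he1 : e ≤ Real.exp (-1))
    (hg : 0 ≤ g) (hcA : 0 ≤ cA) (hcG : 0 ≤ cG) (hcΦ : 0 ≤ cΦ) (hA₀ : 0 ≤ A₀) (hCG0 : 0 ≤ CG) (hVc : 0 ≤ Vc)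
    (hγ0 : ∀ m, 0 ≤ γ m) (hγ : ∀ m, γ m ≤ g * m.factorial * CG ^ m) (hA₀e : A₀ ≤ cA * e * pLog p e)
    (hCGe : CG ≤ cG * e * pLog p e)
    (hVcΦ : Vc ≤ Φ) (hΦ : e * Φ ≤ cΦ * pLog p e) (hG : ∀ z z', ∀ n : ℕ, ContDiff ℝ n (fun t => G t z z'))
    (hU : ∀ y z, z ∈ B y → ‖U y z‖ ≤ 1) (hA : ∀ y z, z ∈ B y → |A y z| ≤ A₀) (hw : ∀ x, |w| * (B x).card ≤ 1)
    (hcol : ∀ z', ∑ y ∈ Y.filter (fun y => z' ∈ B y), |w| * ‖v y‖ ≤ Vc) (nbar : ℕ)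
    (hγG : ∀ t ∈ Set.Icc (0 : ℝ) 1, ∀ m ≤ nbar + 1, ∀ z, ∑ z', ‖iteratedDeriv m (fun s => G s z z') t‖ ≤ γ m)
    (X : Finset β) (cube : β → γι) (c : γι) (hv : ∀ x ∈ X, ‖v x‖ ≤ Φ)
    (hcard : ((X.filter (fun x => cube x = c)).card : ℝ) ≤ rLen r e ^ d) :
    |W1dltCube a B w U A G v Y nbar X cube c|
      ≤ dltConst a g cA cG cΦ nbar * e ^ ((nbar : ℝ) - 1) * Real.log e⁻¹ ^ kinLogPower p r d nbar := by
  have he1' : e ≤ 1 := le_one_of_le_exp_neg_one he1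
  have hK := dltConst_nonneg (a := a) (cΦ := cΦ) hg hcA hcG nbar
  have hsite : ∀ x ∈ X, cube x = c →
      |W1dlt a B w U A G v Y nbar x| ≤ dltConst a g cA cG cΦ nbar * e ^ ((nbar : ℝ) - 1) * pLog p e ^ (nbar + 3) :=
    fun x hx _ => abs_W1dlt_le_scale he hg hcΦ hA₀ hCG0 hVc hγ0 hγ hA₀e hCGe hVcΦ hΦ hG hU hA hw hcol nbar hγG (hv x hx)
  refine (abs_W1dltCube_le a nbar X cube c hsite).trans ?_
  have hb : 0 ≤ dltConst a g cA cG cΦ nbar * e ^ ((nbar : ℝ) - 1) * pLog p e ^ (nbar + 3) :=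
    mul_nonneg (mul_nonneg hK (Real.rpow_nonneg he.le _)) (pow_nonneg (Real.rpow_nonneg (abs_nonneg _) _) _)
  calc ((X.filter (fun x => cube x = c)).card : ℝ) * (dltConst a g cA cG cΦ nbar * e ^ ((nbar : ℝ) - 1) * pLog p e ^ (nbar + 3))
      ≤ rLen r e ^ d * (dltConst a g cA cG cΦ nbar * e ^ ((nbar : ℝ) - 1) * pLog p e ^ (nbar + 3)) :=
        mul_le_mul_of_nonneg_right hcard hb
    _ = dltConst a g cA cG cΦ nbar * e ^ ((nbar : ℝ) - 1) * (pLog p e ^ (nbar + 3) * rLen r e ^ d) := by ring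
    _ = dltConst a g cA cG cΦ nbar * e ^ ((nbar : ℝ) - 1) * Real.log e⁻¹ ^ kinLogPower p r d nbar := by
        congr 1
        rw [pLog_eq_rpow he he1', rLen_eq_rpow he he1', log_rpow_pow he he1', log_rpow_pow he he1',
          log_rpow_mul_log_rpow he he1, kinLogPower]
        push_cast; ring_nf

/-- **`|W₁^{(k)}(□)| ≦ e_k^{n̄−1−α}` for the `Δ_{k,loc}` term** — r16's row leaf `BIJ88Sect5StatementsPart2.Ineq5613` INHABITED by
`W₁ = W₁,Δ(□)`: under the displayed hypotheses of `abs_W1dltCube_le_scale` at every cube and for every running charge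
`0 < e_k ≤ min(e⁻¹, e₀)`, `e₀ = BIJ88Eq5613Summary.threshold K q α` explicit (`K = dltConst …`, `q = kinLogPower … > 0`, `α > 0`).
[cite: BalabanImbrieJaffe1988, (5.6.13) p.288] -/
theorem ineq5613_delta {γι : Type} [DecidableEq γι] {e p r g cA cG cΦ A₀ CG Vc Φ α' : ℝ} {γ : ℕ → ℝ} {d : ℕ} (he : 0 < e)
    (he1 : e ≤ Real.exp (-1)) (hg : 0 ≤ g) (hcA : 0 ≤ cA) (hcG : 0 ≤ cG) (hcΦ : 0 ≤ cΦ) (hA₀ : 0 ≤ A₀) (hCG0 : 0 ≤ CG)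
    (hVc : 0 ≤ Vc) (hγ0 : ∀ m, 0 ≤ γ m) (hγ : ∀ m, γ m ≤ g * m.factorial * CG ^ m) (hA₀e : A₀ ≤ cA * e * pLog p e)
    (hCGe : CG ≤ cG * e * pLog p e) (hVcΦ : Vc ≤ Φ) (hΦ : e * Φ ≤ cΦ * pLog p e)
    (hG : ∀ z z', ∀ n : ℕ, ContDiff ℝ n (fun t => G t z z')) (hU : ∀ y z, z ∈ B y → ‖U y z‖ ≤ 1)
    (hA : ∀ y z, z ∈ B y → |A y z| ≤ A₀) (hw : ∀ x, |w| * (B x).card ≤ 1)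
    (hcol : ∀ z', ∑ y ∈ Y.filter (fun y => z' ∈ B y), |w| * ‖v y‖ ≤ Vc) (nbar : ℕ)
    (hγG : ∀ t ∈ Set.Icc (0 : ℝ) 1, ∀ m ≤ nbar + 1, ∀ z, ∑ z', ‖iteratedDeriv m (fun s => G s z z') t‖ ≤ γ m)
    (X : Finset β) (cube : β → γι) (hv : ∀ x ∈ X, ‖v x‖ ≤ Φ)
    (hcard : ∀ c, ((X.filter (fun x => cube x = c)).card : ℝ) ≤ rLen r e ^ d) (hα : 0 < α')
    (hq : 0 < kinLogPower p r d nbar) (hth : e ≤ threshold (dltConst a g cA cG cΦ nbar) (kinLogPower p r d nbar) α') :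
    Ineq5613 γι (W1dltCube a B w U A G v Y nbar X cube) e nbar α' := by
  refine ineq5613_of_cube_bounds X cube _ he nbar α' fun c _ => ?_
  exact BIJ88Eq5613Summary.absorb_logs_nbar (dltConst_nonneg hg hcA hcG nbar) hq hα he (le_one_of_le_exp_neg_one he1) hth
    (abs_W1dltCube_le_scale he he1 hg hcA hcG hcΦ hA₀ hCG0 hVc hγ0 hγ hA₀e hCGe hVcΦ hΦ hG hU hA hw hcol nbar hγG X cube c
      hv (hcard c))

end Scale

end Literature.MathematicalPhysics.QuantumFieldTheory.BalabanImbrieJaffe1984to88.BIJ88Eq5613DeltaLoc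

end
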